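import Summits.BirchSwinnertonDyer.BirchSwinnertonDyer.Theorems.ThetaPartnerAtTwoSignedKatoUpToAtTwoPairingSumTraceForm
import Summits.BirchSwinnertonDyer.BirchSwinnertonDyer.Theorems.ThetaPartnerAtTwoSignedKatoUpToAtTwoPrimitiveCharValues
import HarnessLib

/-!
# Crux `SupersingularRankZeroAtTwo` (K4, item stmt-BirchSwinnertonDyer-19097), line `odd_blind_package` v2.19, `stub_flatPackage`
# conjunct (8), F3 (the ♭ explicit reciprocity computation at `2`) — FILE E2b-θ: the THREE-TERM RELATION of the Mazur–Tate elements
# for a GENERAL `a_p`: `ω_{n+1} ∣ θ_{n+2} − a_p·θ_{n+1} + Φ_{p^{n+1}}(1+T)·θ_n`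

Seat `bsd-2adic-tower-1` GEN 69, hand «hF3-ERL» (pen GEN 41 SUMMON 20260831T215831Z, director-bsd (979) slot 2). HONEST FRAMING:
theorems only (no definition, no named fact, no instance, no `sorry`); algebra of Mazur–Tate elements (any prime `p`, any rational newform
of level prime to `p`); helper toward conjunct (8) F3 of `stub_flatPackage`; closes no stub and no item; 19097 OPEN; BSD₂ is proved for
no supersingular curve and BSD for no curve by any of this.

## What

The Literature file `PlusMinusPAdicLFunctionProofs` proves `cyclotomicOmega_dvd_mazurTateElement_add` — Mazur–Tate–Teitelbaum §I.10 (10.2)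
`π_{n+2/n+1}(θ_{n+2}) = a_p θ_{n+1} − ν_{n/n+1}(θ_n)` — in the case `a_p = 0` only (`hap : cuspCoeff f p = 0`). The ♭ road at a
supersingular `2` with `a₂ = ±2` (and every ordinary use) needs the middle term. Here, with `hap : cuspCoeff f p = (a : ℂ)` DISPLAYED:

* `sum_fiber_ratPlusSymbol_eq_of_cuspCoeff` — the Hecke relation `a_p [r]⁺ = ∑_{j<p} [(r+j)/p]⁺ + [p r]⁺` (`intCast_mul_ratPlusSymbol`,
  PROVED in the tree) summed over a fibre of `ℤ/p^{L+1} → ℤ/p^L`: `∑_{b ↦ a} [b/p^{L+1}]⁺ = a_p·[a/p^L]⁺ − [p·a/p^L]⁺`;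
* ★ `cyclotomicOmega_dvd_mazurTateElement_sub_add` — in `ℚ[T]`,
  `(cyclotomicOmega p (n+1)).map (Int.castRingHom ℚ) ∣ mazurTateElement f p (n+2) − C (a : ℚ) * mazurTateElement f p (n+1)
   + ((cyclotomic (p^(n+1)) ℤ).comp (X+1)).map (Int.castRingHom ℚ) * mazurTateElement f p n` (same `ω`/`Φ` tokens as the `a_p = 0` theorem);
* `eval₂_mazurTateElement_add_two_eq_of_cuspCoeff` — evaluated at `ζ − 1` with `ζ^{p^{n+1}} = 1`:
  `θ_{n+2}(ζ−1) = a·θ_{n+1}(ζ−1) − (∑_{i<p} ζ^{pⁿ i})·θ_n(ζ−1)`.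
The proof is the Literature one verbatim with the extra term carried (private reindexing/fibre helpers re-proved locally, since the
Literature copies are `private`).

References: [MazurTateTeitelbaum1986Invent] B. Mazur, J. Tate, J. Teitelbaum, Invent. Math. 84 (1986), §I.4 (4.2), §I.10 Prop. (10.2);
[MazurTate1987] Duke Math. J. 54 (1987), (1.3); [Pollack2003] Duke Math. J. 118 (2003), Def. 6.15, Prop. 6.18; [Washington1997] §7.2.
-/

set_option autoImplicit false
-- the Theorems namespace of this sub repeats the summit name by design (D-0017 nested layout)
set_option linter.dupNamespace false

noncomputable section

open scoped Classical MatrixGroups ModularForm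

open CongruenceSubgroup Polynomial
  Literature.NumberTheory.EllipticCurves Literature.NumberTheory.EllipticCurves.ModularForms
  Summit.BirchSwinnertonDyer.BirchSwinnertonDyer.Theorems.SignedKatoOffTwo.CoreChi

namespace Summit.BirchSwinnertonDyer.BirchSwinnertonDyer.Theorems.SSFlatERL


/-! ## The θ-side: `ω_{n+1} ∣ θ_{n+2} − a·θ_{n+1} + Φ_{p^{n+1}}(1+T)·θ_n` for a general `a_p = a` -/

section ThreeTerm

variable {N : ℕ} [NeZero N] {f : CuspForm (Gamma0 N) 2} {p : ℕ} [Fact p.Prime]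

/-- **The fibre sum for a general `a_p`**: for `a mod p^L` (`L' = L + 1`), summing `[b/p^{L'}]⁺_f` over the `p` lifts `b` of `a` to
`ℤ/p^{L'}` gives `a_p·[a/p^L]⁺_f − [p · a/p^L]⁺_f`: the lifts are `a + p^L j`, `j < p` (`filter_castHom_eq_image`),
`(a + p^L j)/p^{L+1} = (a/p^L + j)/p`, and the Hecke relation `a_p [r]⁺ = ∑_j [(r+j)/p]⁺ + [p r]⁺` (`intCast_mul_ratPlusSymbol`).
(`sum_fiber_ratPlusSymbol_eq_neg_of_ap_zero` is the case `a_p = 0`.) [cite: MazurTateTeitelbaum1986Invent, §I.4 (4.2), §I.10 Prop. (10.2)] -/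
theorem sum_fiber_ratPlusSymbol_eq_of_cuspCoeff (hf0 : IsNewform0 f) (hQ : coeffField f = ⊥)
    (hpN : ¬ p ∣ N) {ap : ℤ} (hap : cuspCoeff f p = (ap : ℂ)) {L L' : ℕ} (hL : L' = L + 1)
    (hdvd : p ^ L ∣ p ^ L') (a : ZMod (p ^ L)) :
    ∑ b ∈ Finset.univ.filter (fun b : ZMod (p ^ L') ↦ ZMod.castHom hdvd (ZMod (p ^ L)) b = a),
        ratPlusSymbol f ((b.val : ℚ) / (p : ℚ) ^ L') =
      (ap : ℚ) * ratPlusSymbol f ((a.val : ℚ) / (p : ℚ) ^ L) - ratPlusSymbol f (p * ((a.val : ℚ) / (p : ℚ) ^ L)) := by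
  classical
  subst hL
  have hp : p.Prime := Fact.out
  haveI : NeZero p := ⟨hp.ne_zero⟩
  have hp0 : (p : ℚ) ≠ 0 := Nat.cast_ne_zero.mpr hp.ne_zero
  have hinj : Function.Injective
      (fun j : Fin p ↦ ((a.val + p ^ L * (j : ℕ) : ℕ) : ZMod (p ^ (L + 1)))) := by
    intro j j' h
    have hv := congr_arg ZMod.val h
    simp only [val_classLift] at hv
    exact Fin.ext (Nat.eq_of_mul_eq_mul_left (pow_pos hp.pos L) (by omega))
  rw [filter_castHom_eq_image, Finset.sum_image fun j _ j' _ h ↦ hinj h]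
  set x : ℚ := (a.val : ℚ) / (p : ℚ) ^ L with hx
  have hA : ∀ j : Fin p,
      ((a.val + p ^ L * (j : ℕ) : ℕ) : ℚ) / (p : ℚ) ^ (L + 1) = (x + j) / p := by
    intro j
    rw [hx]
    push_cast
    field_simp
    ring
  have hH := intCast_mul_ratPlusSymbol p hf0 hp hpN hap (fun r ↦ ratCast_ratPlusSymbol_holds hf0 hQ r) x
  have hH' : ∑ j : Fin p, ratPlusSymbol f ((x + j) / p) = (ap : ℚ) * ratPlusSymbol f x - ratPlusSymbol f (p * x) := by
    rw [hH]; ring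
  rw [← hH']
  refine Finset.sum_congr rfl fun j _ ↦ ?_
  rw [val_classLift, hA]

/-- The fibre of `ℤ/p^{L+1} → ℤ/p^L` over any class has exactly `p` elements. [folklore] -/
private theorem card_filter_castHom_eq' {L L' : ℕ} (hL : L' = L + 1) (hdvd : p ^ L ∣ p ^ L')
    (a : ZMod (p ^ L)) :
    (Finset.univ.filter (fun b : ZMod (p ^ L') ↦ ZMod.castHom hdvd (ZMod (p ^ L)) b = a)).card = p := by
  classical
  subst hL
  have hp : p.Prime := Fact.out
  have hinj : Function.Injective
      (fun j : Fin p ↦ ((a.val + p ^ L * (j : ℕ) : ℕ) : ZMod (p ^ (L + 1)))) := by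
    intro j j' h
    have hv := congr_arg ZMod.val h
    simp only [val_classLift] at hv
    exact Fin.ext (Nat.eq_of_mul_eq_mul_left (pow_pos hp.pos L) (by omega))
  rw [filter_castHom_eq_image, Finset.card_image_of_injective _ hinj, Finset.card_univ, Fintype.card_fin]

/-- **An orbit of `δ = γ^{p^{m}}` is a fibre** (`b₀` a unit of `ℤ/p^{L+1}`, `δ` of order `p` reducing to `1` modulo `p^L`):
`{b₀ δ^j : j < p}` is the fibre of `ℤ/p^{L+1} → ℤ/p^L` over `b₀ mod p^L`. [folklore] -/
private theorem image_mul_pow_eq_filter' {L L' : ℕ} (hL : L' = L + 1) (hdvd : p ^ L ∣ p ^ L')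
    {b₀ δ : ZMod (p ^ L')} (hb₀ : IsUnit b₀) (hδ : orderOf δ = p)
    (hδ1 : ZMod.castHom hdvd (ZMod (p ^ L)) δ = 1) :
    Finset.univ.image (fun j : Fin p ↦ b₀ * δ ^ (j : ℕ)) =
      Finset.univ.filter (fun b : ZMod (p ^ L') ↦
        ZMod.castHom hdvd (ZMod (p ^ L)) b = ZMod.castHom hdvd (ZMod (p ^ L)) b₀) := by
  classical
  have hinj : Function.Injective (fun j : Fin p ↦ b₀ * δ ^ (j : ℕ)) := by
    intro j j' h
    have h1 : δ ^ (j : ℕ) = δ ^ (j' : ℕ) := hb₀.mul_right_inj.mp h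
    have h2 := pow_injOn_Iio_orderOf (x := δ) (by rw [hδ]; exact j.2) (by rw [hδ]; exact j'.2) h1
    exact Fin.ext h2
  refine Finset.eq_of_subset_of_card_le (fun b hb ↦ ?_) ?_
  · obtain ⟨j, -, rfl⟩ := Finset.mem_image.mp hb
    simp only [Finset.mem_filter, Finset.mem_univ, true_and, map_mul, map_pow, hδ1, one_pow, mul_one]
  · rw [card_filter_castHom_eq' hL hdvd, Finset.card_image_of_injective _ hinj, Finset.card_univ, Fintype.card_fin]

/-- **Orbit form of the fibre sum** (general `a_p`): with `b₀`, `δ` as in `image_mul_pow_eq_filter'`,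
`∑_{j<p} [b₀δ^j / p^{L+1}]⁺_f = a_p·[(b₀ mod p^L)/p^L]⁺_f − [p · (b₀ mod p^L)/p^L]⁺_f`. [cite: MazurTateTeitelbaum1986Invent, §I.10 Prop. (10.2)] -/
private theorem sum_range_ratPlusSymbol_orbit_eq_of_cuspCoeff (hf0 : IsNewform0 f) (hQ : coeffField f = ⊥)
    (hpN : ¬ p ∣ N) {ap : ℤ} (hap : cuspCoeff f p = (ap : ℂ)) {L L' : ℕ} (hL : L' = L + 1)
    (hdvd : p ^ L ∣ p ^ L') {b₀ δ : ZMod (p ^ L')} (hb₀ : IsUnit b₀) (hδ : orderOf δ = p)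
    (hδ1 : ZMod.castHom hdvd (ZMod (p ^ L)) δ = 1) :
    ∑ j ∈ Finset.range p, ratPlusSymbol f (((b₀ * δ ^ j).val : ℚ) / (p : ℚ) ^ L') =
      (ap : ℚ) * ratPlusSymbol f (((ZMod.castHom hdvd (ZMod (p ^ L)) b₀).val : ℚ) / (p : ℚ) ^ L) -
        ratPlusSymbol f (p * (((ZMod.castHom hdvd (ZMod (p ^ L)) b₀).val : ℚ) / (p : ℚ) ^ L)) := by
  classical
  have hinj : Function.Injective (fun j : Fin p ↦ b₀ * δ ^ (j : ℕ)) := by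
    intro j j' h
    have h1 : δ ^ (j : ℕ) = δ ^ (j' : ℕ) := hb₀.mul_right_inj.mp h
    have h2 := pow_injOn_Iio_orderOf (x := δ) (by rw [hδ]; exact j.2) (by rw [hδ]; exact j'.2) h1
    exact Fin.ext h2
  rw [← sum_fiber_ratPlusSymbol_eq_of_cuspCoeff hf0 hQ hpN hap hL hdvd, ← image_mul_pow_eq_filter' hL hdvd hb₀ hδ hδ1,
    Finset.sum_image fun j _ j' _ h ↦ hinj h,
    ← Fin.sum_univ_eq_sum_range (fun j ↦ ratPlusSymbol f (((b₀ * δ ^ j).val : ℚ) / (p : ℚ) ^ L')) p]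

/-- `[p · x/p^{S+1}]⁺_f = [(x mod p^S)/p^S]⁺_f` for `x mod p^{S+1}` (they differ by an integer). [folklore] -/
private theorem ratPlusSymbol_mul_div_pow_eq' {S I : ℕ} (hI : I = S + 1) (hdvd : p ^ S ∣ p ^ I) (x : ZMod (p ^ I)) :
    ratPlusSymbol f (p * ((x.val : ℚ) / (p : ℚ) ^ I)) =
      ratPlusSymbol f (((ZMod.castHom hdvd (ZMod (p ^ S)) x).val : ℚ) / (p : ℚ) ^ S) := by
  subst hI
  have hp : p.Prime := Fact.out
  haveI : NeZero (p ^ S) := ⟨pow_ne_zero _ hp.ne_zero⟩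
  have hp0 : (p : ℚ) ≠ 0 := Nat.cast_ne_zero.mpr hp.ne_zero
  have hval : (ZMod.castHom hdvd (ZMod (p ^ S)) x).val = x.val % p ^ S := by
    rw [ZMod.castHom_apply, ZMod.cast_eq_val, ZMod.val_natCast]
  set q : ℕ := x.val / p ^ S with hq
  set r : ℕ := x.val % p ^ S with hr
  have hx : (x.val : ℚ) = (r : ℚ) + (p : ℚ) ^ S * (q : ℚ) := by
    rw [hr, hq]
    exact_mod_cast (Nat.mod_add_div x.val (p ^ S)).symm
  have heq : (p : ℚ) * ((x.val : ℚ) / (p : ℚ) ^ (S + 1)) = (r : ℚ) / (p : ℚ) ^ S + ((q : ℤ) : ℚ) := by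
    rw [hx, Int.cast_natCast, pow_succ]
    field_simp
  rw [heq, ratPlusSymbol_add_intCast_eq, hval]

omit [NeZero N] in
/-- The image of `θ_m` under a ring homomorphism `φ : ℚ[T] → R`:
`φ(θ_m) = ∑_η ∑_{k < p^m} φ([η γ^k / p^{m+e₀}]⁺) · φ(1+T)^k`. [folklore] -/
private theorem map_mazurTateElement_eq' {R : Type*} [CommRing R] (φ : ℚ[X] →+* R) (m : ℕ)
    [Fintype (rootsOfUnity (torsionOrder p) ℤ_[p])] :
    φ (mazurTateElement f p m) =
      ∑ w : rootsOfUnity (torsionOrder p) ℤ_[p], ∑ k ∈ Finset.range (p ^ m),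
        φ (C (ratPlusSymbol f
          (((PadicInt.toZModPow (m + cyclotomicExponent p) ((w : ℤ_[p]ˣ) : ℤ_[p]) *
              (cyclotomicGenerator p : ZMod (p ^ (m + cyclotomicExponent p))) ^ k).val : ℚ) /
            (p : ℚ) ^ (m + cyclotomicExponent p)))) * φ (X + 1) ^ k := by
  classical
  haveI : NeZero (p ^ m) := ⟨pow_ne_zero _ (Fact.out : p.Prime).ne_zero⟩
  rw [mazurTateElement, finsum_eq_sum_of_fintype, map_sum]
  refine Finset.sum_congr rfl fun w _ ↦ ?_
  rw [map_sum, sum_range_eq_sum_zmod m (fun k ↦ φ (C (ratPlusSymbol f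
          (((PadicInt.toZModPow (m + cyclotomicExponent p) ((w : ℤ_[p]ˣ) : ℤ_[p]) *
              (cyclotomicGenerator p : ZMod (p ^ (m + cyclotomicExponent p))) ^ k).val : ℚ) /
            (p : ℚ) ^ (m + cyclotomicExponent p)))) * φ (X + 1) ^ k)]
  refine Finset.sum_congr rfl fun s _ ↦ ?_
  rw [map_mul, map_pow]

/-- **The three-term relation of the Mazur–Tate elements for a general `a_p`** (Mazur–Tate–Teitelbaum 1986, §I.10 (10.2):
`π_{n+2/n+1}(θ_{n+2}) = a_p θ_{n+1} − ν_{n/n+1}(θ_n)`, with `ν_{n/n+1} =` multiplication by `Φ_{p^{n+1}}(1+T) = ω_{n+1}/ω_n`): for a rational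
newform `f` of level `N` prime to `p` with `a_p(f) = a`, in `ℚ[T]`,
`ω_{n+1} ∣ θ_{n+2} − C a · θ_{n+1} + Φ_{p^{n+1}}(1+T) · θ_n`.
Proof: in `ℚ[T]/(ω_{n+1})` (`u = 1+T`, `u^{p^{n+1}} = 1`) write `k < p^{n+2}` as `k = t + p^{n+1} j`; the classes `η γ^t (γ^{p^{n+1}})^j`,
`j < p`, form the fibre of `ℤ/p^{n+2+e₀} → ℤ/p^{n+1+e₀}` over `η γ^t`, so the Hecke relation sums them to `a·[ηγ^t/p^{n+1+e₀}]⁺ − [η γ^t/p^{n+e₀}]⁺`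
(`sum_range_ratPlusSymbol_orbit_eq_of_cuspCoeff`); the first terms give `a·θ_{n+1}`, and `t = t' + pⁿ k` collects `∑_{k<p} u^{pⁿ k} = Φ_{p^{n+1}}(u)`
in the second. (`cyclotomicOmega_dvd_mazurTateElement_add` is the case `a = 0`.) [cite: MazurTateTeitelbaum1986Invent, §I.10 Prop. (10.2)] -/
theorem cyclotomicOmega_dvd_mazurTateElement_sub_add (hf0 : IsNewform0 f) (hQ : coeffField f = ⊥)
    (hpN : ¬ p ∣ N) {a : ℤ} (hap : cuspCoeff f p = (a : ℂ)) (n : ℕ) :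
    (cyclotomicOmega p (n + 1)).map (Int.castRingHom ℚ) ∣
      mazurTateElement f p (n + 2) - C (a : ℚ) * mazurTateElement f p (n + 1) +
        ((cyclotomic (p ^ (n + 1)) ℤ).comp (X + 1)).map (Int.castRingHom ℚ) *
          mazurTateElement f p n := by
  classical
  have hp : p.Prime := Fact.out
  haveI := neZero_torsionOrder p
  haveI := Fintype.ofFinite (rootsOfUnity (torsionOrder p) ℤ_[p])
  -- the three levels `S = n + e₀ < I = n + 1 + e₀ < B = n + 2 + e₀`
  have hIS : n + 1 + (cyclotomicExponent p) = (n + (cyclotomicExponent p)) + 1 := by omega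
  have hBI : n + 2 + (cyclotomicExponent p) = (n + 1 + (cyclotomicExponent p)) + 1 := by omega
  have hdvdIS : p ^ (n + (cyclotomicExponent p)) ∣ p ^ (n + 1 + (cyclotomicExponent p)) := pow_dvd_pow p (by omega)
  have hdvdBI : p ^ (n + 1 + (cyclotomicExponent p)) ∣ p ^ (n + 2 + (cyclotomicExponent p)) := pow_dvd_pow p (by omega)
  -- the quotient ring `ℚ[T]/(ω_{n+1})` and `u = 1 + T`
  set ωQ : ℚ[X] := (cyclotomicOmega p (n + 1)).map (Int.castRingHom ℚ) with hωQ
  rw [← AdjoinRoot.mk_eq_zero]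
  set π : ℚ[X] →+* AdjoinRoot ωQ := AdjoinRoot.mk ωQ with hπ
  set u : AdjoinRoot ωQ := π (X + 1) with hu
  have hu1 : u ^ p ^ (n + 1) = 1 := by
    have hω : ((X : ℚ[X]) + 1) ^ p ^ (n + 1) - 1 = ωQ := by
      rw [hωQ, cyclotomicOmega, Polynomial.map_sub, Polynomial.map_pow, Polynomial.map_add,
        Polynomial.map_X, Polynomial.map_one]
    have h0 : π (((X : ℚ[X]) + 1) ^ p ^ (n + 1) - 1) = 0 := by
      rw [hω]
      exact AdjoinRoot.mk_self
    rw [map_sub, map_pow, map_one, sub_eq_zero] at h0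
    rw [hu, h0]
  have hupow : ∀ i j : ℕ, u ^ (i + p ^ (n + 1) * j) = u ^ i := fun i j ↦ by
    rw [pow_add, pow_mul, hu1, one_pow, mul_one]
  -- `γ` at the three levels
  have hγS : (cyclotomicGenerator p : ZMod (p ^ (n + (cyclotomicExponent p)))) ^ p ^ n = 1 := by
    rw [← orderOf_cyclotomicGenerator p n, pow_orderOf_eq_one]
  have hγI : (cyclotomicGenerator p : ZMod (p ^ (n + 1 + (cyclotomicExponent p)))) ^ p ^ (n + 1) = 1 := by
    rw [← orderOf_cyclotomicGenerator p (n + 1), pow_orderOf_eq_one]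
  have hδord : orderOf ((cyclotomicGenerator p : ZMod (p ^ (n + 2 + (cyclotomicExponent p)))) ^ p ^ (n + 1)) = p := by
    rw [orderOf_pow' _ (pow_ne_zero _ hp.ne_zero), orderOf_cyclotomicGenerator p (n + 2),
      Nat.gcd_eq_right (pow_dvd_pow p (by omega : n + 1 ≤ n + 2)), Nat.pow_div (by omega) hp.pos,
      show n + 2 - (n + 1) = 1 by omega, pow_one]
  have hδ1 : ZMod.castHom hdvdBI (ZMod (p ^ (n + 1 + (cyclotomicExponent p))))
      ((cyclotomicGenerator p : ZMod (p ^ (n + 2 + (cyclotomicExponent p)))) ^ p ^ (n + 1)) = 1 := by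
    rw [map_pow, map_natCast, hγI]
  have hpdiv : ∀ v : ℚ, (p : ℚ) * (v / (p : ℚ) ^ (n + 1 + (cyclotomicExponent p))) = v / (p : ℚ) ^ (n + (cyclotomicExponent p)) := by
    intro v
    have hp0 : (p : ℚ) ≠ 0 := Nat.cast_ne_zero.mpr hp.ne_zero
    rw [hIS, pow_succ]
    field_simp
  -- `A w k = [η γ^k / p^{n+e₀}]⁺`, `B w t = [η γ^t / p^{n+1+e₀}]⁺`
  set A : rootsOfUnity (torsionOrder p) ℤ_[p] → ℕ → ℚ := fun w k ↦ ratPlusSymbol f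
    (((PadicInt.toZModPow (n + (cyclotomicExponent p)) ((w : ℤ_[p]ˣ) : ℤ_[p]) *
        (cyclotomicGenerator p : ZMod (p ^ (n + (cyclotomicExponent p)))) ^ k).val : ℚ) / (p : ℚ) ^ (n + (cyclotomicExponent p)))
    with hA
  set B : rootsOfUnity (torsionOrder p) ℤ_[p] → ℕ → ℚ := fun w t ↦ ratPlusSymbol f
    (((PadicInt.toZModPow (n + 1 + (cyclotomicExponent p)) ((w : ℤ_[p]ˣ) : ℤ_[p]) *
        (cyclotomicGenerator p : ZMod (p ^ (n + 1 + (cyclotomicExponent p)))) ^ t).val : ℚ) /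
      (p : ℚ) ^ (n + 1 + (cyclotomicExponent p))) with hB
  set T : AdjoinRoot ωQ := ∑ w : rootsOfUnity (torsionOrder p) ℤ_[p], ∑ k ∈ Finset.range p,
    ∑ t ∈ Finset.range (p ^ n), π (C (A w t)) * (u ^ t * (u ^ p ^ n) ^ k) with hT
  set T₁ : AdjoinRoot ωQ := ∑ w : rootsOfUnity (torsionOrder p) ℤ_[p], ∑ t ∈ Finset.range (p ^ (n + 1)),
    π (C (B w t)) * u ^ t with hT₁
  -- `π(θ_n)`, `π(θ_{n+1})` and `π(Φ_{p^{n+1}}(1+T))`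
  have hθn : π (mazurTateElement f p n) =
      ∑ w : rootsOfUnity (torsionOrder p) ℤ_[p], ∑ t ∈ Finset.range (p ^ n), π (C (A w t)) * u ^ t := by
    rw [map_mazurTateElement_eq' π n]
  have hθn1 : π (mazurTateElement f p (n + 1)) = T₁ := by
    rw [map_mazurTateElement_eq' π (n + 1)]
  have hξ : π (((cyclotomic (p ^ (n + 1)) ℤ).comp (X + 1)).map (Int.castRingHom ℚ)) =
      ∑ k ∈ Finset.range p, (u ^ p ^ n) ^ k := by
    rw [cyclotomic_prime_pow_eq_geom_sum hp, Polynomial.sum_comp, Polynomial.map_sum, map_sum]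
    refine Finset.sum_congr rfl fun k _ ↦ ?_
    rw [pow_comp, pow_comp, X_comp, Polynomial.map_pow, Polynomial.map_pow, Polynomial.map_add,
      Polynomial.map_X, Polynomial.map_one, map_pow, map_pow]
  have hRHS : π (((cyclotomic (p ^ (n + 1)) ℤ).comp (X + 1)).map (Int.castRingHom ℚ)) *
      π (mazurTateElement f p n) = T := by
    rw [hξ, hθn, Finset.mul_sum]
    refine Finset.sum_congr rfl fun w _ ↦ ?_
    rw [Finset.sum_mul]
    refine Finset.sum_congr rfl fun k _ ↦ ?_
    rw [Finset.mul_sum]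
    refine Finset.sum_congr rfl fun t _ ↦ ?_
    ring
  -- `π(θ_{n+2}) = a · T₁ - T`
  have hLHS : π (mazurTateElement f p (n + 2)) = (a : AdjoinRoot ωQ) * T₁ - T := by
    rw [map_mazurTateElement_eq' π (n + 2), ← hu]
    -- Step 1: `k = t + p^{n+1} j`, the `j`-sum is an orbit sum
    have h1 : ∀ w : rootsOfUnity (torsionOrder p) ℤ_[p],
        ∑ k ∈ Finset.range (p ^ (n + 2)),
          π (C (ratPlusSymbol f
            (((PadicInt.toZModPow (n + 2 + (cyclotomicExponent p)) ((w : ℤ_[p]ˣ) : ℤ_[p]) *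
                (cyclotomicGenerator p : ZMod (p ^ (n + 2 + (cyclotomicExponent p)))) ^ k).val : ℚ) /
              (p : ℚ) ^ (n + 2 + (cyclotomicExponent p))))) * u ^ k =
        ∑ t ∈ Finset.range (p ^ (n + 1)),
          (π (C ((a : ℚ) * B w t)) - π (C (ratPlusSymbol f
            (((PadicInt.toZModPow (n + 1 + (cyclotomicExponent p)) ((w : ℤ_[p]ˣ) : ℤ_[p]) *
                (cyclotomicGenerator p : ZMod (p ^ (n + 1 + (cyclotomicExponent p)))) ^ t).val : ℚ) /
              (p : ℚ) ^ (n + (cyclotomicExponent p)))))) * u ^ t := by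
      intro w
      rw [show p ^ (n + 2) = p ^ (n + 1) * p by ring, sum_range_mul_eq_sum_sum, Finset.sum_comm]
      refine Finset.sum_congr rfl fun t _ ↦ ?_
      simp_rw [hupow t]
      rw [← Finset.sum_mul, ← map_sum, ← map_sum, ← map_sub, ← C_sub]
      congr 3
      -- the orbit sum
      set b₀ : ZMod (p ^ (n + 2 + (cyclotomicExponent p))) :=
        PadicInt.toZModPow (n + 2 + (cyclotomicExponent p)) ((w : ℤ_[p]ˣ) : ℤ_[p]) *
          (cyclotomicGenerator p : ZMod (p ^ (n + 2 + (cyclotomicExponent p)))) ^ t with hb₀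
      have hb₀u : IsUnit b₀ :=
        ((Units.isUnit _).map _).mul ((isUnit_cyclotomicGenerator_cast p _).pow _)
      have horb := sum_range_ratPlusSymbol_orbit_eq_of_cuspCoeff hf0 hQ hpN hap hBI hdvdBI hb₀u hδord hδ1
      have hcast : ZMod.castHom hdvdBI (ZMod (p ^ (n + 1 + (cyclotomicExponent p)))) b₀ =
          PadicInt.toZModPow (n + 1 + (cyclotomicExponent p)) ((w : ℤ_[p]ˣ) : ℤ_[p]) *
            (cyclotomicGenerator p : ZMod (p ^ (n + 1 + (cyclotomicExponent p)))) ^ t := by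
        rw [hb₀, map_mul, map_pow, map_natCast, ZMod.castHom_apply,
          PadicInt.cast_toZModPow _ _ (by omega)]
      rw [hcast, hpdiv] at horb
      rw [hB]
      dsimp only
      rw [← horb]
      refine Finset.sum_congr rfl fun j _ ↦ ?_
      rw [hb₀, pow_add (cyclotomicGenerator p : ZMod (p ^ (n + 2 + (cyclotomicExponent p)))) t (p ^ (n + 1) * j),
        pow_mul (cyclotomicGenerator p : ZMod (p ^ (n + 2 + (cyclotomicExponent p)))) (p ^ (n + 1)) j, mul_assoc]
    -- Step 2: `[p · x/p^{n+1+e₀}]⁺ = [(x mod p^{n+e₀})/p^{n+e₀}]⁺` and `t = t' + p^n k`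
    have h2 : ∀ w : rootsOfUnity (torsionOrder p) ℤ_[p],
        ∑ t ∈ Finset.range (p ^ (n + 1)),
          π (C (ratPlusSymbol f
            (((PadicInt.toZModPow (n + 1 + (cyclotomicExponent p)) ((w : ℤ_[p]ˣ) : ℤ_[p]) *
                (cyclotomicGenerator p : ZMod (p ^ (n + 1 + (cyclotomicExponent p)))) ^ t).val : ℚ) /
              (p : ℚ) ^ (n + (cyclotomicExponent p))))) * u ^ t =
        ∑ k ∈ Finset.range p, ∑ t ∈ Finset.range (p ^ n),
          π (C (A w t)) * (u ^ t * (u ^ p ^ n) ^ k) := by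
      intro w
      rw [show p ^ (n + 1) = p ^ n * p by ring, sum_range_mul_eq_sum_sum]
      refine Finset.sum_congr rfl fun k _ ↦ ?_
      refine Finset.sum_congr rfl fun t _ ↦ ?_
      have hx : ∀ x : ZMod (p ^ (n + 1 + (cyclotomicExponent p))),
          ratPlusSymbol f ((x.val : ℚ) / (p : ℚ) ^ (n + (cyclotomicExponent p))) =
            ratPlusSymbol f (((ZMod.castHom hdvdIS (ZMod (p ^ (n + (cyclotomicExponent p)))) x).val : ℚ) /
              (p : ℚ) ^ (n + (cyclotomicExponent p))) := by
        intro x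
        rw [← ratPlusSymbol_mul_div_pow_eq' hIS hdvdIS x, hpdiv]
      rw [hx, map_mul, map_pow, map_natCast, ZMod.castHom_apply,
        PadicInt.cast_toZModPow _ _ (by omega),
        pow_add (cyclotomicGenerator p : ZMod (p ^ (n + (cyclotomicExponent p)))) t (p ^ n * k),
        pow_mul (cyclotomicGenerator p : ZMod (p ^ (n + (cyclotomicExponent p)))) (p ^ n) k, hγS, one_pow, mul_one,
        pow_add u t (p ^ n * k), pow_mul u (p ^ n) k]
    have h3 : ∀ w : rootsOfUnity (torsionOrder p) ℤ_[p],
        ∑ t ∈ Finset.range (p ^ (n + 1)),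
          (π (C ((a : ℚ) * B w t)) - π (C (ratPlusSymbol f
            (((PadicInt.toZModPow (n + 1 + (cyclotomicExponent p)) ((w : ℤ_[p]ˣ) : ℤ_[p]) *
                (cyclotomicGenerator p : ZMod (p ^ (n + 1 + (cyclotomicExponent p)))) ^ t).val : ℚ) /
              (p : ℚ) ^ (n + (cyclotomicExponent p)))))) * u ^ t =
        (a : AdjoinRoot ωQ) * ∑ t ∈ Finset.range (p ^ (n + 1)), π (C (B w t)) * u ^ t -
          ∑ k ∈ Finset.range p, ∑ t ∈ Finset.range (p ^ n), π (C (A w t)) * (u ^ t * (u ^ p ^ n) ^ k) := by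
      intro w
      rw [← h2 w, Finset.mul_sum, ← Finset.sum_sub_distrib]
      refine Finset.sum_congr rfl fun t _ ↦ ?_
      rw [C_mul, map_mul, Polynomial.C_eq_intCast, map_intCast]
      ring
    simp_rw [h1, h3]
    rw [Finset.sum_sub_distrib, hT, hT₁, ← Finset.mul_sum]
  rw [map_add, map_sub, map_mul, map_mul, hLHS, hRHS, hθn1, Polynomial.C_eq_intCast, map_intCast]
  ring

/-- **The three-term relation for a general `a_p`, evaluated at a character of `G_{n+1}`**: for `ζ ∈ ℂ_p` with `ζ^{p^{n+1}} = 1`,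
`θ_{n+2}(ζ − 1) = a·θ_{n+1}(ζ − 1) − (∑_{i<p} ζ^{pⁿ i}) · θ_n(ζ − 1)`. (`CoreChi.eval₂_mazurTateElement_add_two_eq` is the case `a = 0`.)
[cite: MazurTateTeitelbaum1986Invent, §I.10 Prop. (10.2)] -/
theorem eval₂_mazurTateElement_add_two_eq_of_cuspCoeff (hf0 : IsNewform0 f) (hQ : coeffField f = ⊥) (hpN : ¬ p ∣ N)
    {a : ℤ} (hap : cuspCoeff f p = (a : ℂ)) (n : ℕ) {ζ : ℂ_[p]} (hζ : ζ ^ p ^ (n + 1) = 1) :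
    (mazurTateElement f p (n + 2)).eval₂ (algebraMap ℚ ℂ_[p]) (ζ - 1) =
      (a : ℂ_[p]) * (mazurTateElement f p (n + 1)).eval₂ (algebraMap ℚ ℂ_[p]) (ζ - 1) -
        (∑ i ∈ Finset.range p, ζ ^ (p ^ n * i)) * (mazurTateElement f p n).eval₂ (algebraMap ℚ ℂ_[p]) (ζ - 1) := by
  obtain ⟨q, hq⟩ := cyclotomicOmega_dvd_mazurTateElement_sub_add hf0 hQ hpN hap n
  set ι : ℚ →+* ℂ_[p] := algebraMap ℚ ℂ_[p] with hι
  have h := congrArg (Polynomial.eval₂ ι (ζ - 1)) hq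
  -- `ω_{n+1}(ζ - 1) = 0`
  have hω : ((cyclotomicOmega p (n + 1)).map (Int.castRingHom ℚ)).eval₂ ι (ζ - 1) = 0 := by
    rw [eval₂_map, cyclotomicOmega, eval₂_sub, eval₂_pow, eval₂_add, eval₂_X, eval₂_one, sub_add_cancel, hζ, sub_self]
  -- `Φ_{p^{n+1}}(1+T)` at `ζ - 1` is `∑_{i<p} ζ^{pⁿ i}`
  have hΦ : (((cyclotomic (p ^ (n + 1)) ℤ).comp (X + 1)).map (Int.castRingHom ℚ)).eval₂ ι (ζ - 1) =
      ∑ i ∈ Finset.range p, ζ ^ (p ^ n * i) := by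
    rw [eval₂_map, cyclotomic_prime_pow_eq_geom_sum (Fact.out : p.Prime), Polynomial.sum_comp, eval₂_finsetSum]
    refine Finset.sum_congr rfl fun i _ ↦ ?_
    rw [pow_comp, pow_comp, X_comp, eval₂_pow, eval₂_pow, eval₂_add, eval₂_X, eval₂_one, sub_add_cancel, pow_mul]
  rw [eval₂_mul, hω, zero_mul, eval₂_add, eval₂_sub, eval₂_mul, eval₂_mul, eval₂_C, hΦ, map_intCast] at h
  linear_combination h

end ThreeTerm

end Summit.BirchSwinnertonDyer.BirchSwinnertonDyer.Theorems.SSFlatERL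

end
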